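/-
Copyright (c) 2026. All rights reserved.
Released under Apache 2.0 license as described in the file LICENSE.
-/
import Literature.Computability.QuantumComplexity.CleanXorDesc
import Literature.Computability.QuantumComplexity.CoreDescBlockFP
import Literature.Computability.Complexity.CodeFPBudgets
import Literature.Computability.Complexity.CodeFPStrings
import Literature.Computability.Complexity.TVCorrector

/-!
# The clean reversible block's sizes in UNARY on codes

`RevSim.NN_codeFP` puts the tableau wire count `NN e M n` on codes in BINARY from `n` in unary.  The stage
descriptions of the uniformity proof need the block SIZES as unary context data (`GRBlockWordCosFP.blockAN_cos_codeFP_of`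
takes `wlen` in unary; `GRTableMach.wlen τ ℓ np` is a maximum of `width (cosE τ) (cosM τ) (·) − (·)`).  Here, for a
fixed machine, `Tn`, `Sn`, `LW`, `PP`, `ancN`, `NN`, `JJ`, `copyN` and `width` are put on codes `unE → unE`
(polynomials in `n` with the machine's constants; unary product `TVCorr.unMulC`, unary powers `unitsPow`).
[cite: AroraBarak2009, §1.3 and §6.2 (proof of Thm. 6.15)] [cite: Regev2009, Lemma 3.14 (proof)]

HONEST FRAMING: the VALUE is a THEOREM (kernel-checked lemmas of a KNOWN reduction, Regev 2009) — NOT summit progress.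
-/

noncomputable section

namespace Literature.Computability.QuantumComplexity

open _root_.Computability Cryptography Complexity Complexity.CodeFP SLP RevDesc AJLCore RevSim RevClean

namespace RevClean

variable (e : ℕ) (M : Turing.TM2ComputableAux Bool Bool)

/-- `T(n) = (n+2)^e` in unary on codes. [cite: AroraBarak2009, §1.3] -/
theorem Tn_unary : CodeFP unE unE (fun n => Tn e n) :=
  ((ulength unitE).comp ((unitsPow e).comp (unSucc.comp unSucc))).congr fun n => by
    show (List.replicate ((n + 1 + 1) ^ e) ()).length = (n + 2) ^ e
    rw [List.length_replicate]

/-- `S(n) = n + d·T(n) + 2d` in unary on codes. [cite: AroraBarak2009, §1.3] -/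
theorem Sn_unary : CodeFP unE unE (fun n => Sn M.tm e n) :=
  (unAdd.comp ((unAdd.comp ((CodeFP.id unE).pair ((unMulConst (dd M.tm)).comp (Tn_unary e)))).pair
    (const unE (2 * dd M.tm)))).congr fun _ => rfl

/-- The layer-block width `LW(n) = nC + (S(n) + d)·CW` in unary on codes. [cite: AroraBarak2009, §1.3] -/
theorem LW_unary : CodeFP unE unE (fun n => LW M.tm e n) :=
  (unAdd.comp ((const unE (nC M.tm)).pair ((unMulConst (CW M.tm)).comp (unAdd.comp ((Sn_unary e M).pair
    (const unE (dd M.tm))))))).congr fun n => by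
    show nC M.tm + CW M.tm * (Sn M.tm e n + dd M.tm) = nC M.tm + (Sn M.tm e n + dd M.tm) * CW M.tm
    rw [Nat.mul_comm]

/-- `PP(n) = LW(n) + RW` in unary on codes. [cite: AroraBarak2009, §1.3] -/
theorem PP_unary : CodeFP unE unE (fun n => PP M.tm e n) :=
  (unAdd.comp ((LW_unary e M).pair (const unE (RW M.tm)))).congr fun _ => rfl

/-- The ancilla count `ancN(n) = T(n)·PP(n) + LW(n) + 1` in unary on codes. [cite: AroraBarak2009, §1.3] -/
theorem ancN_unary : CodeFP unE unE (fun n => ancN M.tm e n) :=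
  (unAdd.comp ((unAdd.comp ((TVCorr.unMulC.comp ((Tn_unary e).pair (PP_unary e M))).pair (LW_unary e M))).pair
    (const unE 1))).congr fun _ => rfl

/-- **The tableau wire count `NN e M n` in unary on codes.** [cite: AroraBarak2009, §1.3 and §6.2 (proof of Thm. 6.15)] -/
theorem NN_unary : CodeFP unE unE (NN e M) :=
  (unAdd.comp ((CodeFP.id unE).pair (ancN_unary e M))).congr fun _ => rfl

/-- The read-out cell count `JJ e M n = S(n) + d` in unary on codes. [cite: AroraBarak2009, §1.3] -/
theorem JJ_unary : CodeFP unE unE (JJ e M) :=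
  (unAdd.comp ((Sn_unary e M).pair (const unE (dd M.tm)))).congr fun _ => rfl

/-- The result-wire count `copyN e M n = JJ(n)·A₁` in unary on codes. [cite: AroraBarak2009, §1.3] -/
theorem copyN_unary : CodeFP unE unE (copyN e M) :=
  ((unMulConst (A₁ M)).comp (JJ_unary e M)).congr fun n => by
    show A₁ M * JJ e M n = JJ e M n * A₁ M
    rw [Nat.mul_comm]

/-- **The clean block's total width `width e M n = NN(n) + copyN(n)` in unary on codes.**
[cite: AroraBarak2009, §1.3 and §6.2 (proof of Thm. 6.15)] [cite: Regev2009, Lemma 3.14 (proof)] -/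
theorem width_unary : CodeFP unE unE (width e M) :=
  (unAdd.comp ((NN_unary e M).pair (copyN_unary e M))).congr fun _ => rfl

/-- The width in binary on codes. [cite: AroraBarak2009, §6.2 (proof of Thm. 6.15)] -/
theorem width_codeFP : CodeFP unE natE (width e M) := BP.toNat (width_unary e M)

/-- **The width at a context-given input length, in unary.** [cite: AroraBarak2009, §6.2 (proof of Thm. 6.15)] -/
theorem width_unary_of {σ : Type} {eσ : σ → List Bool} {N : σ → ℕ} (hN : CodeFP eσ unE N) :
    CodeFP eσ unE (fun c => width e M (N c)) := (width_unary e M).comp hN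

end RevClean

end Literature.Computability.QuantumComplexity

end
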